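/-
Copyright (c) 2026 the pub-hodgecm-mathlib formalisation cell (harness21).  Prover seat hodgecm-mathlib-K2Liu-p07 (g0),
Track B «K2-LIT» ∕ hLiu418 #184♮, unit U5 «DOUBLING ZETA», organ (IV-d) of socket #16b `sig_K2LiuAdelicNormIntegrable`,
FILE (2) of K2Liu-p03 (g2)'s plan `K2/K2Liu-p03/g2/PLAN-16b-AdelicNormIntegrable.v1.K2Liu-p03-g2.md` (ARCH):
the archimedean height ball of `GL_n(K_∞)` has polynomially growing Haar volume.  2026-09-03.
-/
import Literature.NumberTheory.Automorphic.HaarGLnArchCoordinates     -- ★ `coordHaarGL`, `haarWeightGL`, `lFlow`, `glCoord`, `unitOfCoord`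
import Literature.NumberTheory.Automorphic.AdelicGLnGlue             -- ★ `GLn.archHeight`, `GLn.ofInfinite`, `GLn.toMixed_ofInfinite`
import Mathlib.MeasureTheory.Measure.Lebesgue.EqHaar                 -- `Measure.addHaar_smul`
import HarnessLib

/-!
# K2_Liu road (hLiu418 = stmt-HodgeConjecture-24832), unit U5, organ (IV-d) «Weil's adelic integrability», FILE (2):
# the Haar volume of the archimedean height ball `{x ∈ GL_n(K_∞) : H_∞(x) ≤ T}` is `≤ C · T^D`

Cell `pub/hodgecm-mathlib` (D-0151), Track B (21-frontier RULING «PUSH BOTH» 2026-09-03, director req621∕req624,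
LEAD F0P6-plan «M-154j»); socket #16b `sig_K2LiuAdelicNormIntegrable` of
`Summits/HodgeConjecture/HodgeConjecture/Cruxes/HLiu418/Lines/K2_Liu_CurveThetaSigs_U5_DoublingZeta.lean` (ED. 5 :266), steward
K2Liu-p03 (g2), whose plan (file 5, the «smearing» Tonelli inequality ★ `K2LiuSmearingVolumeBound`) reduces the volume growth
`ν{g ∈ G : ‖g‖ ≤ T} ≤ C T^D` of any closed `G ≤ GL_N(𝔸_L)` to the two factors `GL_N(L ⊗ ℝ)`, `GL_N(𝔸_{L,f})`.  THIS FILE is the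
ARCHIMEDEAN factor: for every Haar measure `μ` on `GL_n(K_∞) = GL_n(ℝ^{r₁} × ℂ^{r₂})` (`K_∞ = mixedSpace K`) there are
`C > 0`, `D : ℕ` with `μ{x : H_∞(x) ≤ T} ≤ C · T^D` for `T ≥ 1`, where `H_∞(x) = max_{i,j}(‖x_{ij}‖ ⊔ ‖(x⁻¹)_{ij}‖)` is the
archimedean height ★ `GLn.archHeight n K (GLn.ofInfinite n K x)` (★ `GLn.toMixed_ofInfinite`); the shape of the conclusion is
the hypothesis `hvol` of ★ `K2LiuSmearingVolumeBound.integrable_rpow_neg_of_measure_le` token for token.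

THE MATHEMATICS (Bourbaki, *Intégration* VII §1 no. 10: the Haar measure of the unit group of a finite-dimensional real
algebra `A` is `|det L_x|⁻¹ dx`; here `A = M_n(K_∞)`, `d = dim_ℝ A`).  In the tree's linear coordinates ★ `glCoord : A ≃L ℝ^d`
every Haar measure is `c · haarWeightGL(s)⁻¹ ds` with `haarWeightGL(s) = |det L_{x(s)}|` (★ `HaarGLnArchCoordinates`: `coordHaarGL`,
`coordHaarGL_apply`, Haar uniqueness as in ★ `exists_integral_haar_eq_integral_unitPull`).  On the ball `E_T = {H_∞ ≤ T}`:
(i) DENSITY — `|det L_x|⁻¹ = |det L_{x⁻¹}|` (`L_x L_{x⁻¹} = 1`, ★ `lFlow_mul`, `lFlow_one`) and `L_{t y} = t L_y`, so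
`|det L_{x⁻¹}| = T^d |det L_{x⁻¹/T}| ≤ T^d · M`, `M = max |det L_y|` over the COMPACT entry box `{‖y_{ij}‖ ≤ 1}`
(★ `continuous_haarWeightGL`) — HOMOGENEITY + COMPACTNESS instead of Hadamard's inequality;
(ii) VOLUME — the coordinates of `E_T` lie in `T • glCoord(box₁)`, of Lebesgue measure `T^d · vol(glCoord(box₁))` (Mathlib
`Measure.addHaar_smul`).  Hence `μ(E_T) ≤ c⁻¹ M vol · T^{2d}`: `D = 2d`.

* §1 `lFlow_smul`, `abs_det_lFlow_smul` (homogeneity), `abs_det_lFlow_mul_abs_det_lFlow_inv` (`|det L_x| |det L_{x⁻¹}| = 1`),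
  `isCompact_entryBox`, `exists_bound_abs_det_lFlow` and `abs_det_lFlow_le_mul_pow` (the density bound on the height ball);
* §2 `nnnorm_apply_le_archHeight_ofInfinite`, `isClosed_entryBall`, `coordHaarGL_entryBall_le` (the estimate for the coordinate Haar
  measure) and the head **`archHeightBallVolume`** (any Haar `μ`).

HONEST LABEL: HC_CM is proved only modulo the 7 printed citations (2 remaining named inputs: hLiu418 = stmt-HodgeConjecture-24832,
h413 = stmt-HodgeConjecture-24833) until rung 0 closes; this file is a `--supports stmt-HodgeConjecture-24832` helper (file (2) of 6
toward #16b) and retires nothing by itself.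

## References
* [BorelJacquet1979] A. Borel, H. Jacquet, *Automorphic forms and automorphic representations*, PSPM 33.1 (1979), §1.2 (the height
  `‖g‖`, its moderate growth and integrability properties).
* [MoeglinWaldspurger1995] C. Mœglin, J.-L. Waldspurger, *Spectral decomposition and Eisenstein series* (1995), I.2.2.
* N. Bourbaki, *Intégration*, Ch. VII §1 no. 10 [folklore].
-/

set_option autoImplicit false
-- the mandated namespace repeats the single-problem summit's segment (`HodgeConjecture.HodgeConjecture`)
set_option linter.dupNamespace false

noncomputable section

open scoped MatrixGroups Matrix Topology ENNReal NNReal Pointwise Classical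
open MeasureTheory NumberField NumberField.mixedEmbedding Set

namespace Summit.HodgeConjecture.HodgeConjecture.Cruxes.HLiu418.K2LiuArchHeightBallVolume

open Literature.NumberTheory.Automorphic

variable {n : ℕ} {K : Type} [Field K] [NumberField K]

/-! ## §1 Homogeneity and the density bound on the height ball -/

/-- `L_{t h} = t · L_h` in coordinates (★ `lFlow`). [folklore] -/
theorem lFlow_smul (t : ℝ) (h : Matrix (Fin n) (Fin n) (mixedSpace K)) :
    lFlow (n := n) (K := K) (t • h) = t • lFlow h := by
  refine LinearMap.ext fun s => ?_
  rw [lFlow_apply, LinearMap.smul_apply, lFlow_apply, Matrix.smul_mul, map_smul]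

/-- **Homogeneity of the Haar weight**: `|det L_{t h}| = |t|^d · |det L_h|`, `d = dim_ℝ ℝ^d` the dimension of the coordinate space
(Mathlib `LinearMap.det_smul`). [folklore] -/
theorem abs_det_lFlow_smul (t : ℝ) (h : Matrix (Fin n) (Fin n) (mixedSpace K)) :
    |LinearMap.det (lFlow (n := n) (K := K) (t • h))| =
      |t| ^ Module.finrank ℝ (GlIdx n K → ℝ) * |LinearMap.det (lFlow (n := n) (K := K) h)| := by
  rw [lFlow_smul, LinearMap.det_smul, abs_mul, abs_pow]

/-- **`|det L_x| · |det L_{x⁻¹}| = 1`** for `x ∈ GL_n(K_∞)` (`L_x ∘ L_{x⁻¹} = L_1 = id`, ★ `lFlow_mul`, `lFlow_one`). [folklore] -/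
theorem abs_det_lFlow_mul_abs_det_lFlow_inv (g : GL (Fin n) (mixedSpace K)) :
    |LinearMap.det (lFlow (g : Matrix (Fin n) (Fin n) (mixedSpace K)))| *
        |LinearMap.det (lFlow ((g⁻¹ : GL (Fin n) (mixedSpace K)) : Matrix (Fin n) (Fin n) (mixedSpace K)))| = 1 := by
  rw [← abs_mul, ← LinearMap.det_comp, ← lFlow_mul, Units.mul_inv, lFlow_one, LinearMap.det_id, abs_one]

/-- The entry box `{y : ‖y_{ij}‖ ≤ 1}` of `M_n(K_∞)` is compact (a finite product of closed unit balls of the proper space `K_∞`). [folklore] -/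
theorem isCompact_entryBox :
    IsCompact {y : Matrix (Fin n) (Fin n) (mixedSpace K) | ∀ i j, ‖y i j‖ ≤ 1} := by
  change IsCompact {y : Fin n → Fin n → mixedSpace K | ∀ i j, ‖y i j‖ ≤ 1}
  have h : {y : Fin n → Fin n → mixedSpace K | ∀ i j, ‖y i j‖ ≤ 1} =
      Set.univ.pi fun _ : Fin n => Set.univ.pi fun _ : Fin n => Metric.closedBall (0 : mixedSpace K) 1 := by
    ext y
    simp only [Set.mem_setOf_eq, Set.mem_univ_pi, Metric.mem_closedBall, dist_zero_right]
  rw [h]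
  exact isCompact_univ_pi fun _ => isCompact_univ_pi fun _ => isCompact_closedBall _ _

/-- **`|det L_y|` is bounded on the entry box** `{‖y_{ij}‖ ≤ 1}` (continuity of ★ `haarWeightGL ∘ glCoord` on a compact set). [folklore] -/
theorem exists_bound_abs_det_lFlow :
    ∃ M : ℝ, 0 ≤ M ∧ ∀ y : Matrix (Fin n) (Fin n) (mixedSpace K), (∀ i j, ‖y i j‖ ≤ 1) →
      |LinearMap.det (lFlow (n := n) (K := K) y)| ≤ M := by
  have hcont : Continuous fun y : Matrix (Fin n) (Fin n) (mixedSpace K) => haarWeightGL n K (glCoord n K y) :=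
    continuous_haarWeightGL.comp (glCoord n K).continuous
  obtain ⟨M, hM⟩ := isCompact_entryBox.bddAbove_image hcont.continuousOn
  refine ⟨max M 0, le_max_right _ _, fun y hy => ?_⟩
  have h : haarWeightGL n K (glCoord n K y) ≤ M := hM ⟨y, hy, rfl⟩
  rw [haarWeightGL, matOf_glCoord] at h
  exact h.trans (le_max_left _ _)

/-- **The density bound on the height ball**: if `‖y_{ij}‖ ≤ T` for all `i, j` (`T ≥ 1`) then `|det L_y| ≤ M · T^d` with `M` the bound
of `exists_bound_abs_det_lFlow` (`y = T · (y/T)`, homogeneity). [folklore] -/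
theorem abs_det_lFlow_le_mul_pow {M : ℝ} (hM : ∀ y : Matrix (Fin n) (Fin n) (mixedSpace K), (∀ i j, ‖y i j‖ ≤ 1) →
      |LinearMap.det (lFlow (n := n) (K := K) y)| ≤ M)
    {T : ℝ} (hT : 1 ≤ T) (y : Matrix (Fin n) (Fin n) (mixedSpace K)) (hy : ∀ i j, ‖y i j‖ ≤ T) :
    |LinearMap.det (lFlow (n := n) (K := K) y)| ≤ M * T ^ Module.finrank ℝ (GlIdx n K → ℝ) := by
  have hT0 : 0 < T := lt_of_lt_of_le zero_lt_one hT
  have hy' : ∀ i j, ‖(T⁻¹ • y) i j‖ ≤ 1 := fun i j => by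
    rw [show (T⁻¹ • y) i j = T⁻¹ • y i j from rfl, _root_.norm_smul, norm_inv, Real.norm_of_nonneg hT0.le]
    exact (inv_mul_le_iff₀ hT0).2 (by rw [mul_one]; exact hy i j)
  have hdec : y = T • (T⁻¹ • y) := by rw [smul_smul, mul_inv_cancel₀ hT0.ne', one_smul]
  rw [hdec, abs_det_lFlow_smul, abs_of_pos hT0, mul_comm]
  exact mul_le_mul_of_nonneg_right (hM _ hy') (pow_nonneg hT0.le _)

/-! ## §2 The volume of the height ball -/

/-- Entries of `x` and `x⁻¹` are bounded by the archimedean height `H_∞(x)` (★ `GLn.archHeight` through ★ `GLn.ofInfinite`,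
★ `GLn.toMixed_ofInfinite`). [cite: BorelJacquet1979, §1.2] -/
theorem nnnorm_apply_le_archHeight_ofInfinite (x : GL (Fin n) (mixedSpace K)) (i j : Fin n) :
    ‖(x : Matrix (Fin n) (Fin n) (mixedSpace K)) i j‖₊ ≤ GLn.archHeight n K (GLn.ofInfinite n K x) ∧
      ‖((x⁻¹ : GL (Fin n) (mixedSpace K)) : Matrix (Fin n) (Fin n) (mixedSpace K)) i j‖₊ ≤
        GLn.archHeight n K (GLn.ofInfinite n K x) := by
  unfold GLn.archHeight
  rw [GLn.toMixed_ofInfinite]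
  have h := Finset.le_sup (f := fun ij : Fin n × Fin n => ‖(x : Matrix (Fin n) (Fin n) (mixedSpace K)) ij.1 ij.2‖₊ ⊔
    ‖((x⁻¹ : GL (Fin n) (mixedSpace K)) : Matrix (Fin n) (Fin n) (mixedSpace K)) ij.1 ij.2‖₊) (Finset.mem_univ (i, j))
  exact ⟨le_sup_left.trans h, le_sup_right.trans h⟩

/-- The entrywise height ball `{x : ‖x_{ij}‖ ≤ T, ‖(x⁻¹)_{ij}‖ ≤ T}` is closed in `GL_n(K_∞)`. [folklore] -/
theorem isClosed_entryBall (T : ℝ) :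
    IsClosed {x : GL (Fin n) (mixedSpace K) | ∀ i j, ‖(x : Matrix (Fin n) (Fin n) (mixedSpace K)) i j‖ ≤ T ∧
      ‖((x⁻¹ : GL (Fin n) (mixedSpace K)) : Matrix (Fin n) (Fin n) (mixedSpace K)) i j‖ ≤ T} := by
  have h : {x : GL (Fin n) (mixedSpace K) | ∀ i j, ‖(x : Matrix (Fin n) (Fin n) (mixedSpace K)) i j‖ ≤ T ∧
      ‖((x⁻¹ : GL (Fin n) (mixedSpace K)) : Matrix (Fin n) (Fin n) (mixedSpace K)) i j‖ ≤ T} =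
      ⋂ i, ⋂ j, ({x : GL (Fin n) (mixedSpace K) | ‖(x : Matrix (Fin n) (Fin n) (mixedSpace K)) i j‖ ≤ T} ∩
        {x : GL (Fin n) (mixedSpace K) | ‖((x⁻¹ : GL (Fin n) (mixedSpace K)) : Matrix (Fin n) (Fin n) (mixedSpace K)) i j‖ ≤ T}) := by
    ext x
    simp only [Set.mem_setOf_eq, Set.mem_iInter, Set.mem_inter_iff]
  rw [h]
  refine isClosed_iInter fun i => isClosed_iInter fun j => IsClosed.inter ?_ ?_
  · exact isClosed_le ((Units.continuous_val.matrix_elem i j).norm) continuous_const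
  · exact isClosed_le ((Units.continuous_coe_inv.matrix_elem i j).norm) continuous_const

section Volume

variable [MeasurableSpace (GL (Fin n) (mixedSpace K))] [BorelSpace (GL (Fin n) (mixedSpace K))]

/-- **The coordinate Haar measure of the height ball**: with `M` as in `exists_bound_abs_det_lFlow` and `box₁` the entry box,
`coordHaarGL {‖x_{ij}‖, ‖(x⁻¹)_{ij}‖ ≤ T} ≤ (M T^d) · (T^d · vol(glCoord(box₁)))` for `T ≥ 1` (★ `coordHaarGL_apply`; density ≤ `M T^d` by
`|det L_x|⁻¹ = |det L_{x⁻¹}|` and §1; the coordinates lie in `T • glCoord(box₁)`, Mathlib `Measure.addHaar_smul`). [folklore] -/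
theorem coordHaarGL_entryBall_le {M : ℝ}
    (hM : ∀ y : Matrix (Fin n) (Fin n) (mixedSpace K), (∀ i j, ‖y i j‖ ≤ 1) → |LinearMap.det (lFlow (n := n) (K := K) y)| ≤ M)
    {T : ℝ} (hT : 1 ≤ T) :
    coordHaarGL n K {x : GL (Fin n) (mixedSpace K) | ∀ i j, ‖(x : Matrix (Fin n) (Fin n) (mixedSpace K)) i j‖ ≤ T ∧
        ‖((x⁻¹ : GL (Fin n) (mixedSpace K)) : Matrix (Fin n) (Fin n) (mixedSpace K)) i j‖ ≤ T} ≤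
      ENNReal.ofReal (M * T ^ Module.finrank ℝ (GlIdx n K → ℝ)) *
        (ENNReal.ofReal (T ^ Module.finrank ℝ (GlIdx n K → ℝ)) *
          volume (glCoord n K '' {y : Matrix (Fin n) (Fin n) (mixedSpace K) | ∀ i j, ‖y i j‖ ≤ 1})) := by
  have hT0 : 0 < T := lt_of_lt_of_le zero_lt_one hT
  set d : ℕ := Module.finrank ℝ (GlIdx n K → ℝ) with hd
  set E : Set (GL (Fin n) (mixedSpace K)) := {x | ∀ i j, ‖(x : Matrix (Fin n) (Fin n) (mixedSpace K)) i j‖ ≤ T ∧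
    ‖((x⁻¹ : GL (Fin n) (mixedSpace K)) : Matrix (Fin n) (Fin n) (mixedSpace K)) i j‖ ≤ T} with hE
  set B : Set (Matrix (Fin n) (Fin n) (mixedSpace K)) := {y | ∀ i j, ‖y i j‖ ≤ 1} with hB
  set V : Set (GlIdx n K → ℝ) := T • (glCoord n K '' B) with hV
  have hEm : MeasurableSet E := (isClosed_entryBall T).measurableSet
  -- the coordinates of the ball lie in `V = T • glCoord(B)`
  have hcoordV : ∀ y : Matrix (Fin n) (Fin n) (mixedSpace K), (∀ i j, ‖y i j‖ ≤ T) → glCoord n K y ∈ V := by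
    intro y hy
    have hy' : ∀ i j, ‖(T⁻¹ • y) i j‖ ≤ 1 := fun i j => by
      rw [show (T⁻¹ • y) i j = T⁻¹ • y i j from rfl, _root_.norm_smul, norm_inv, Real.norm_of_nonneg hT0.le]
      exact (inv_mul_le_iff₀ hT0).2 (by rw [mul_one]; exact hy i j)
    have hdec : glCoord n K y = T • glCoord n K (T⁻¹ • y) := by
      rw [← map_smul, smul_smul, mul_inv_cancel₀ hT0.ne', one_smul]
    rw [hdec]
    exact Set.smul_mem_smul_set ⟨T⁻¹ • y, hy', rfl⟩
  have hVc : IsCompact V := (isCompact_entryBox.image (glCoord n K).continuous).smul T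
  have hVm : MeasurableSet V := hVc.measurableSet
  -- pointwise bound of the integrand of `coordHaarGL_apply`
  have hpt : ∀ s ∈ glUnitSet n K,
      E.indicator (1 : GL (Fin n) (mixedSpace K) → ℝ≥0∞) (unitOfCoord n K s) * coordDensityGL n K s ≤
        V.indicator (fun _ => ENNReal.ofReal (M * T ^ d)) s := by
    intro s hs
    by_cases hsE : unitOfCoord n K s ∈ E
    · -- the unit `g` with coordinates `s`
      set g : GL (Fin n) (mixedSpace K) := unitOfCoord n K s with hg
      have hgs : glCoord n K (g : Matrix (Fin n) (Fin n) (mixedSpace K)) = s := glCoord_unitOfCoord hs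
      have hmat : matOf s = (g : Matrix (Fin n) (Fin n) (mixedSpace K)) := by rw [← hgs, matOf_glCoord]
      have hsV : s ∈ V := by rw [← hgs]; exact hcoordV _ fun i j => (hsE i j).1
      rw [Set.indicator_of_mem hsE, Set.indicator_of_mem hsV, Pi.one_apply, one_mul]
      -- density: `(haarWeightGL s)⁻¹ = |det L_{g⁻¹}| ≤ M T^d`
      have hw : haarWeightGL n K s = |LinearMap.det (lFlow (g : Matrix (Fin n) (Fin n) (mixedSpace K)))| := by
        rw [haarWeightGL, hmat]
      have hprod := abs_det_lFlow_mul_abs_det_lFlow_inv g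
      have hinv : (haarWeightGL n K s)⁻¹ =
          |LinearMap.det (lFlow ((g⁻¹ : GL (Fin n) (mixedSpace K)) : Matrix (Fin n) (Fin n) (mixedSpace K)))| := by
        rw [hw]
        exact (eq_inv_of_mul_eq_one_right hprod).symm
      have hbd := abs_det_lFlow_le_mul_pow hM hT _ fun i j => (hsE i j).2
      rw [coordDensityGL, hinv]
      exact ENNReal.ofReal_le_ofReal hbd
    · rw [Set.indicator_of_notMem hsE, zero_mul]
      exact bot_le
  -- integrate
  calc coordHaarGL n K E
      = ∫⁻ s in glUnitSet n K, E.indicator 1 (unitOfCoord n K s) * coordDensityGL n K s := coordHaarGL_apply hEm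
    _ ≤ ∫⁻ s in glUnitSet n K, V.indicator (fun _ => ENNReal.ofReal (M * T ^ d)) s :=
        setLIntegral_mono' isOpen_glUnitSet.measurableSet fun s hs => hpt s hs
    _ ≤ ∫⁻ s, V.indicator (fun _ => ENNReal.ofReal (M * T ^ d)) s := setLIntegral_le_lintegral _ _
    _ = ENNReal.ofReal (M * T ^ d) * volume V := lintegral_indicator_const hVm _
    _ = ENNReal.ofReal (M * T ^ d) * (ENNReal.ofReal (T ^ d) * volume (glCoord n K '' B)) := by
        rw [hV, Measure.addHaar_smul, abs_of_pos (pow_pos hT0 _)]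

/-- **THE ARCHIMEDEAN HEIGHT BALL HAS POLYNOMIALLY GROWING HAAR VOLUME** (file (2) of K2Liu-p03 (g2)'s plan for #16b).  For every number
field `K`, every `n` and every Haar measure `μ` on `GL_n(K_∞)`, `K_∞ = ℝ^{r₁} × ℂ^{r₂}` (Borel σ-algebra as a binder, as in ★
`HaarGLnArchCoordinates`), there are `C > 0` and `D : ℕ` with `μ {x : H_∞(x) ≤ T} ≤ C · T^D` for all `T ≥ 1`, where
`H_∞(x) = ` ★ `GLn.archHeight n K (GLn.ofInfinite n K x) = max_{i,j} (‖x_{ij}‖ ⊔ ‖(x⁻¹)_{ij}‖)` (★ `GLn.toMixed_ofInfinite`).  Proof: Haar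
uniqueness `coordHaarGL = c • μ` (`c ≠ 0`, ★ `coordHaarGL_univ_ne_zero`), the height ball lies in the entrywise ball, and
`coordHaarGL_entryBall_le`; `D = 2 dim_ℝ M_n(K_∞)`.  (`n = 0`: the group is trivial and the bound reads `μ(univ) ≤ C`.)
[cite: BorelJacquet1979, §1.2] [cite: MoeglinWaldspurger1995, I.2.2] -/
theorem archHeightBallVolume :
    ∀ (K : Type) [Field K] [NumberField K] (n : ℕ) [MeasurableSpace (GL (Fin n) (mixedSpace K))]
      [BorelSpace (GL (Fin n) (mixedSpace K))] (μ : Measure (GL (Fin n) (mixedSpace K))) [μ.IsHaarMeasure],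
      ∃ C : ℝ, ∃ D : ℕ, 0 < C ∧ ∀ T : ℝ, 1 ≤ T →
        μ {x | (GLn.archHeight n K (GLn.ofInfinite n K x) : ℝ) ≤ T} ≤ ENNReal.ofReal (C * T ^ D) := by
  intro K _ _ n _ _ μ _
  -- Haar uniqueness: `coordHaarGL = c • μ`, `c ≠ 0` (as in ★ `exists_integral_haar_eq_integral_unitPull`)
  haveI : LocallyCompactSpace (GL (Fin n) (mixedSpace K)) := locallyCompactSpace_glInf n K
  haveI : SecondCountableTopology (GL (Fin n) (mixedSpace K)) := secondCountableTopology_glInf n K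
  haveI : IsFiniteMeasureOnCompacts (coordHaarGL n K) := isFiniteMeasureOnCompacts_coordHaarGL
  haveI : (coordHaarGL n K).IsMulLeftInvariant := isMulLeftInvariant_coordHaarGL
  have heq : coordHaarGL n K = Measure.haarScalarFactor (coordHaarGL n K) μ • μ :=
    Measure.isMulLeftInvariant_eq_smul _ _
  set c : ℝ≥0 := Measure.haarScalarFactor (coordHaarGL n K) μ with hc
  have hc0 : c ≠ 0 := by
    intro h0
    apply coordHaarGL_univ_ne_zero (n := n) (K := K)
    rw [heq, h0]
    simp
  have hμ : ∀ A : Set (GL (Fin n) (mixedSpace K)), μ A = ((c : ℝ≥0∞))⁻¹ * coordHaarGL n K A := fun A => by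
    rw [heq, Measure.coe_nnreal_smul_apply, ← mul_assoc,
      ENNReal.inv_mul_cancel (ENNReal.coe_ne_zero.2 hc0) ENNReal.coe_ne_top, one_mul]
  -- the constants
  obtain ⟨M, hM0, hM⟩ := exists_bound_abs_det_lFlow (n := n) (K := K)
  set d : ℕ := Module.finrank ℝ (GlIdx n K → ℝ) with hd
  set B : Set (Matrix (Fin n) (Fin n) (mixedSpace K)) := {y | ∀ i j, ‖y i j‖ ≤ 1} with hB
  have hvolB : volume (glCoord n K '' B) ≠ ∞ :=
    ((isCompact_entryBox (n := n) (K := K)).image (glCoord n K).continuous).measure_lt_top.ne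
  set vB : ℝ := (volume (glCoord n K '' B)).toReal with hvB
  have hvB0 : 0 ≤ vB := ENNReal.toReal_nonneg
  have hcMv : 0 ≤ (c : ℝ)⁻¹ * M * vB := mul_nonneg (mul_nonneg (inv_nonneg.2 (NNReal.coe_nonneg _)) hM0) hvB0
  refine ⟨(c : ℝ)⁻¹ * M * vB + 1, 2 * d, by linarith, fun T hT => ?_⟩
  have hT0 : 0 < T := lt_of_lt_of_le zero_lt_one hT
  -- the height ball lies in the entrywise ball
  have hsub : {x : GL (Fin n) (mixedSpace K) | (GLn.archHeight n K (GLn.ofInfinite n K x) : ℝ) ≤ T} ⊆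
      {x | ∀ i j, ‖(x : Matrix (Fin n) (Fin n) (mixedSpace K)) i j‖ ≤ T ∧
        ‖((x⁻¹ : GL (Fin n) (mixedSpace K)) : Matrix (Fin n) (Fin n) (mixedSpace K)) i j‖ ≤ T} := by
    intro x hx i j
    have hx' : (GLn.archHeight n K (GLn.ofInfinite n K x) : ℝ) ≤ T := hx
    have h := nnnorm_apply_le_archHeight_ofInfinite x i j
    exact ⟨(NNReal.coe_le_coe.2 h.1).trans hx', (NNReal.coe_le_coe.2 h.2).trans hx'⟩
  -- assemble
  have hball := coordHaarGL_entryBall_le (n := n) (K := K) hM hT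
  have hcR : ((c : ℝ≥0∞))⁻¹ = ENNReal.ofReal ((c : ℝ)⁻¹) := by
    rw [ENNReal.ofReal_inv_of_pos (NNReal.coe_pos.2 (pos_iff_ne_zero.2 hc0)), ENNReal.ofReal_coe_nnreal]
  calc μ {x : GL (Fin n) (mixedSpace K) | (GLn.archHeight n K (GLn.ofInfinite n K x) : ℝ) ≤ T}
      ≤ μ {x | ∀ i j, ‖(x : Matrix (Fin n) (Fin n) (mixedSpace K)) i j‖ ≤ T ∧
          ‖((x⁻¹ : GL (Fin n) (mixedSpace K)) : Matrix (Fin n) (Fin n) (mixedSpace K)) i j‖ ≤ T} := measure_mono hsub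
    _ = ((c : ℝ≥0∞))⁻¹ * coordHaarGL n K _ := hμ _
    _ ≤ ((c : ℝ≥0∞))⁻¹ * (ENNReal.ofReal (M * T ^ d) * (ENNReal.ofReal (T ^ d) * volume (glCoord n K '' B))) :=
        mul_le_mul_of_nonneg_left hball bot_le
    _ = ENNReal.ofReal ((c : ℝ)⁻¹ * ((M * T ^ d) * (T ^ d * vB))) := by
        rw [hcR, ← ENNReal.ofReal_toReal hvolB, ← hvB, ← ENNReal.ofReal_mul (pow_nonneg hT0.le _),
          ← ENNReal.ofReal_mul (mul_nonneg hM0 (pow_nonneg hT0.le _)), ← ENNReal.ofReal_mul (inv_nonneg.2 (NNReal.coe_nonneg _))]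
    _ ≤ ENNReal.ofReal (((c : ℝ)⁻¹ * M * vB + 1) * T ^ (2 * d)) := by
        refine ENNReal.ofReal_le_ofReal ?_
        have hTd : (1 : ℝ) ≤ T ^ (2 * d) := one_le_pow₀ hT
        have hsplit : T ^ (2 * d) = T ^ d * T ^ d := by rw [two_mul, pow_add]
        calc (c : ℝ)⁻¹ * ((M * T ^ d) * (T ^ d * vB)) = (c : ℝ)⁻¹ * M * vB * T ^ (2 * d) := by rw [hsplit]; ring
          _ ≤ (c : ℝ)⁻¹ * M * vB * T ^ (2 * d) + 1 * T ^ (2 * d) :=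
              le_add_of_nonneg_right (by rw [one_mul]; exact le_trans zero_le_one hTd)
          _ = ((c : ℝ)⁻¹ * M * vB + 1) * T ^ (2 * d) := by ring

end Volume

end Summit.HodgeConjecture.HodgeConjecture.Cruxes.HLiu418.K2LiuArchHeightBallVolume

end
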